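import Summits.ABC.IUTFork.Conditional.AbcOfCor312Slack
import Literature.IUT.LogVolume.Corollary22PartIIDisplayAt
import HarnessLib

/-!
# The Σ-VARIANT, «abc WITH A WORSE CONSTANT»: a slack BUDGET `K` beyond the tolerance of print's roundings is paid by
# `η_prm ↦ η_prm + K` alone, i.e. by the constant `C_K = 40·η_prm + 2·B_K` of [IUTchIV] Cor. 2.2 (ii) (C2) — `H_unif = 2^140` unchanged

PROOF-ONLY sequel (no `def`, no new `Prop`, no instance, no notation) of this seat's core `Conditional/AbcOfCor312Slack.lean` (p469667:
`Cor312Slack.display_of_squeezeIII_slack`, tolerance `E ≤ ((l+1)/4)·5·(d*·l + η_prm)`) and of `Literature/IUT/LogVolume/Corollary22PartIIDisplayAt.lean`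
(`Cor22.partII_of_displayAt`: the proof of record of Cor. 2.2 (ii) consumes the display at ONE `η_prm`; `Cor22.isEtaPrm_mono`). R-H ROUND 2 seat
abc-iut-rh2-q2-cond (rh-lead 2026-08-26T19:48:27Z «S|Σ ⇒ weakened Cor 3.12 ⇒ abc-with-worse-constant»). TAKES NO SIDE on [IUTchIII] Cor. 3.12 or on
any author. S. Mochizuki, *Inter-universal Teichmüller theory IV* (RIMS Apr. 2020 = PRIMS **57** (2021)), Prop. 1.6 p. 16, Thm. 1.10 pp. 22–31,
Cor. 2.2 (ii) pp. 41–48 ("`C_K`", p. 47) [claim: Mochizuki2012, status: disputed].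

WHAT IS TYPED (notation of the core file; `d* = 2^{12}·3^3·5·d_mod`, `Tol_K(P,l) := ((l+1)/4)·5·(d*·l + K)` for a budget `K ≥ 0`):
* `displayAt_of_cor312Slack_budget` — [NUMΣ] the weakened number-level Corollary `T.negAbsLogQ ≤ T.negLogTheta + ε P l T` at every genuine
  datum of every admissible `(P, l)`, [TOL-K] `ε P l T ≤ Tol_K(P,l)`, [CONE] `hreg` verbatim, and ONE `η₀` with `IsEtaPrm η₀` ⟹ print's display
  `Cor22.Display P l (η₀ + K)` at every admissible `(P, l)` — AT THE SHIFTED `η_prm := η₀ + K` (so `C_K ↦ C_K + 40·K` in (C2), nothing else moves);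
* `ThetaPartII_of_cor312Slack_budget`, **`ABC_of_cor312Slack_budget`** — hence the crux `ThetaPartII` (`H_II = 2^140`) and `ABC`, through
  `Cor22.exists_partII_of_displayAt`, `Cor22.fullGaloisImage_holds`, the route's `closes`, `genEllTwo_holds`, `JInvWlog_proof` (all PROVED).
READING (numbers): the budget-free tolerance is `K = 0` (core file: `691200·d_mod·l(l+1)` in the currency of `−|log(Θ)|`); every further
`((l+1)/4)·5·K` of off-Σ remainder costs `+40·K` in `C_K` and is invisible in `ABC` (`∀ ε ∃ C`) — this is the precise sense of «abc with a worse
constant». A remainder growing with `log(q)` faster than `O(d_mod·l²)` is NOT a constant budget (in Cor. 2.2 (ii) `l ≥ log(q^∀)^{1/2}`); it moves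
abc's exponent (not typed here). HONEST FRAMING: conditional on assumption labels for the disputed inequality; nothing asserts abc, Thm. 1.10 or
Cor. 3.12 (with or without slack); typed ≠ proved; instantiated ≠ endorsed. [cite: Mochizuki2012, IUTchIV Prop. 1.6 p. 16; Thm. 1.10 pp. 22–31; Cor. 2.2 (ii) pp. 41–48]
[cite: Mochizuki2012, IUTchIII Cor. 3.12 p. 174] [claim: Mochizuki2012, status: disputed]
-/

noncomputable section

namespace Summit.ABC.IUTFork.Conditional.Cor312Slack

open Literature.IUT.LogVolume Literature.IUT.HodgeTheaters Literature.NumberTheory.DiophantineGeometry.GenEll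
open Summit.ABC.ABC.Theorems NumberField IsDedekindDomain

/-- **Print's display AT THE SHIFTED `η_prm := η₀ + K` from the weakened Corollary with a BUDGETED slack `ε ≤ ((l+1)/4)·5·(d*·l + K)` and the cone
binder** — per admissible `(P, l)`: a genuine datum exists (abc-iut-L5-t7 `ThetaPartII.stub_thetaData`), the hull estimate with `B_III` holds at it
(`ThetaPartII.hullVolume_of_hullRegime`), the slack squeeze (`logQAvoid_le_of_cor312Slack`), `l ≠ 5` from (P6) (abc-iut-S-d1 `Cor22.exists_isThetaField`,
`Cor22.not_condP6_five_of_isThetaField`), and `display_of_squeezeIII_slack` at `η₀ + K` (`IsEtaPrm` by `Cor22.isEtaPrm_mono`; `K ≤ η₀ + K`). CONDITIONAL on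
`h312ε`, `hTolK`, `hreg`; no side taken. [cite: Mochizuki2012, IUTchIV Thm. 1.10 pp. 22–31; Prop. 1.6 p. 16] [claim: Mochizuki2012, status: disputed] -/
theorem displayAt_of_cor312Slack_budget {K : ℝ} (hK : 0 ≤ K) {η₀ : ℝ} (hη₀ : IsEtaPrm η₀)
    (ε : ∀ (P : NFPoint) (l : ℕ), Cor22.ThetaVolumeDatumAt P l → ℝ)
    (h312ε : ∀ P : NFPoint, P ∈ UP → ∀ l : ℕ, l.Prime → 5 ≤ l →
      Cor22.AdmitsCore P → Cor22.CondP2 P l → Cor22.CondP5 P l → Cor22.CondP6 P l →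
      ∀ T : Cor22.ThetaVolumeDatumAt P l, T.negAbsLogQ ≤ T.negLogTheta + ε P l T)
    (hTolK : ∀ P : NFPoint, P ∈ UP → ∀ l : ℕ, l.Prime → 5 ≤ l →
      Cor22.AdmitsCore P → Cor22.CondP2 P l → Cor22.CondP5 P l → Cor22.CondP6 P l →
      ∀ T : Cor22.ThetaVolumeDatumAt P l,
        ε P l T ≤ ((l : ℝ) + 1) / 4 * (5 * ((((2 ^ 12 * 3 ^ 3 * 5 * Cor22.dmod P : ℕ) : ℝ)) * l + K)))
    (hreg : ∀ P : NFPoint, P ∈ UP → ∀ l : ℕ, l.Prime → 5 ≤ l →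
      Cor22.AdmitsCore P → Cor22.CondP2 P l → Cor22.CondP5 P l → Cor22.CondP6 P l →
      ∀ T : Cor22.ThetaVolumeDatumAt P l,
        (letI := T.instFieldF; letI := T.instNumberFieldF; letI := T.instAlgebraF; letI := T.instFieldK
         letI := T.instNumberFieldK; letI := T.instAlgebraK; letI := T.instFieldFbar; letI := T.instAlgebraFbar
         letI := T.instAlgebraKFbar; letI := T.instIsElliptic
         ¬ (∀ p ∈ T.I.supportPrimes, ∀ v w : placesOver (fieldOfModuli T.E) p,
            (Summit.ABC.IUTFork.DHData.ofInput T.I).logQloc p v = (Summit.ABC.IUTFork.DHData.ofInput T.I).logQloc p w)) →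
        T.HullEstimateOf
          (((l : ℝ) + 1) / 4 *
            ((1 + 12 * (Cor22.dmod P : ℝ) / l) * (P.logDiff + Cor22.logCondAvoid P {2, l})
              + 2 * Real.log l + 52
              + 20 / 3 * Real.log (((2 ^ 12 * 3 ^ 3 * 5 * Cor22.dmod P : ℕ) : ℝ) * (l : ℝ))
                * (Nat.primeCounting (2 ^ 12 * 3 ^ 3 * 5 * Cor22.dmod P * l) : ℝ)))) :
    ∀ P : NFPoint, P ∈ UP → ∀ l : ℕ, l.Prime → 5 ≤ l →
      Cor22.AdmitsCore P → Cor22.CondP2 P l → Cor22.CondP5 P l → Cor22.CondP6 P l → Cor22.Display P l (η₀ + K) := by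
  intro P hP l hl h5 hcore hP2 hP5 h6
  have hη : IsEtaPrm (η₀ + K) := Cor22.isEtaPrm_mono hη₀ (by linarith)
  have hU : P.InU := hP.1
  have hne : l ≠ 5 := by
    rintro rfl
    obtain ⟨F, hNF, hF⟩ := Cor22.exists_isThetaField P hU
    haveI := hNF
    exact Cor22.not_condP6_five_of_isThetaField hU F hF h6
  obtain ⟨T⟩ := ThetaPartII.stub_thetaData P hP l hl h5 hcore hP2 hP5 h6
  have hgap := logQAvoid_le_of_cor312Slack T hU (h312ε P hP l hl h5 hcore hP2 hP5 h6 T)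
    (ThetaPartII.hullVolume_of_hullRegime hreg P hP l hl h5 hcore hP2 hP5 h6 T)
  refine display_of_squeezeIII_slack hl h5 hne hη (le_trans (hTolK P hP l hl h5 hcore hP2 hP5 h6 T) ?_) hgap
  have hη0 : 0 < η₀ := hη₀.1
  have hc : (0 : ℝ) ≤ ((l : ℝ) + 1) / 4 := by positivity
  exact mul_le_mul_of_nonneg_left (by linarith) hc

/-- **The crux `ThetaPartII` from the weakened Corollary with a BUDGETED slack** (`K ≥ 0`): `η₀` from Prop. 1.6 (`exists_isEtaPrm`, PROVED),
the display at `η₀ + K` (`displayAt_of_cor312Slack_budget`), then [IUTchIV] Cor. 2.2 (ii) at that single `η_prm` (`Cor22.exists_partII_of_displayAt`,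
`C_K = 40·(η₀ + K) + 2·B_K`, `H_II = 2^140`) with the proved `Cor22.fullGaloisImage_holds`. CONDITIONAL; does not close any item; no side taken.
[cite: Mochizuki2012, IUTchIV Cor. 2.2 (ii) pp. 41–48] [claim: Mochizuki2012, status: disputed] -/
theorem ThetaPartII_of_cor312Slack_budget {K : ℝ} (hK : 0 ≤ K)
    (ε : ∀ (P : NFPoint) (l : ℕ), Cor22.ThetaVolumeDatumAt P l → ℝ)
    (h312ε : ∀ P : NFPoint, P ∈ UP → ∀ l : ℕ, l.Prime → 5 ≤ l →
      Cor22.AdmitsCore P → Cor22.CondP2 P l → Cor22.CondP5 P l → Cor22.CondP6 P l →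
      ∀ T : Cor22.ThetaVolumeDatumAt P l, T.negAbsLogQ ≤ T.negLogTheta + ε P l T)
    (hTolK : ∀ P : NFPoint, P ∈ UP → ∀ l : ℕ, l.Prime → 5 ≤ l →
      Cor22.AdmitsCore P → Cor22.CondP2 P l → Cor22.CondP5 P l → Cor22.CondP6 P l →
      ∀ T : Cor22.ThetaVolumeDatumAt P l,
        ε P l T ≤ ((l : ℝ) + 1) / 4 * (5 * ((((2 ^ 12 * 3 ^ 3 * 5 * Cor22.dmod P : ℕ) : ℝ)) * l + K)))
    (hreg : ∀ P : NFPoint, P ∈ UP → ∀ l : ℕ, l.Prime → 5 ≤ l →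
      Cor22.AdmitsCore P → Cor22.CondP2 P l → Cor22.CondP5 P l → Cor22.CondP6 P l →
      ∀ T : Cor22.ThetaVolumeDatumAt P l,
        (letI := T.instFieldF; letI := T.instNumberFieldF; letI := T.instAlgebraF; letI := T.instFieldK
         letI := T.instNumberFieldK; letI := T.instAlgebraK; letI := T.instFieldFbar; letI := T.instAlgebraFbar
         letI := T.instAlgebraKFbar; letI := T.instIsElliptic
         ¬ (∀ p ∈ T.I.supportPrimes, ∀ v w : placesOver (fieldOfModuli T.E) p,
            (Summit.ABC.IUTFork.DHData.ofInput T.I).logQloc p v = (Summit.ABC.IUTFork.DHData.ofInput T.I).logQloc p w)) →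
        T.HullEstimateOf
          (((l : ℝ) + 1) / 4 *
            ((1 + 12 * (Cor22.dmod P : ℝ) / l) * (P.logDiff + Cor22.logCondAvoid P {2, l})
              + 2 * Real.log l + 52
              + 20 / 3 * Real.log (((2 ^ 12 * 3 ^ 3 * 5 * Cor22.dmod P : ℕ) : ℝ) * (l : ℝ))
                * (Nat.primeCounting (2 ^ 12 * 3 ^ 3 * 5 * Cor22.dmod P * l) : ℝ)))) :
    Summit.ABC.ABC.Theses.IUTThetaPilot.ThetaPartII := by
  obtain ⟨η₀, hη₀⟩ := exists_isEtaPrm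
  unfold Summit.ABC.ABC.Theses.IUTThetaPilot.ThetaPartII
  exact Cor22.exists_partII_of_displayAt (Cor22.isEtaPrm_mono hη₀ (by linarith))
    (displayAt_of_cor312Slack_budget hK hη₀ ε h312ε hTolK hreg) Cor22.fullGaloisImage_holds

/-- **`abc` FROM THE WEAKENED COROLLARY WITH A BUDGETED SLACK AND THE CONE BINDER — «abc with a worse constant»**: for any budget `K ≥ 0`,
[NUMΣ] `−|log(q)| ≤ −|log(Θ)| + ε(P,l,T)` at every genuine Θ-volume datum of every admissible `(P, l)` (ASSUMPTION LABEL; the weakened Corollary an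
`S_H|Σ`-certificate delivers), [TOL-K] `ε(P,l,T) ≤ ((l+1)/4)·5·(d*_mod·l + K)`, [CONE] `hreg` verbatim ⟹ `ABC` — the budget is paid inside by
`η_prm ↦ η_prm + K`, i.e. `C_K ↦ C_K + 40·K` in Cor. 2.2 (ii) (C2), invisible in `ABC`'s `∀ ε ∃ C`. CONDITIONAL; nothing is asserted about the
hypotheses; no side taken. [cite: Mochizuki2012, IUTchIV Cor. 2.2–2.3 pp. 41–55] [cite: Mochizuki2012, IUTchIII Cor. 3.12 p. 174]
[claim: Mochizuki2012, status: disputed] -/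
theorem ABC_of_cor312Slack_budget {K : ℝ} (hK : 0 ≤ K)
    (ε : ∀ (P : NFPoint) (l : ℕ), Cor22.ThetaVolumeDatumAt P l → ℝ)
    (h312ε : ∀ P : NFPoint, P ∈ UP → ∀ l : ℕ, l.Prime → 5 ≤ l →
      Cor22.AdmitsCore P → Cor22.CondP2 P l → Cor22.CondP5 P l → Cor22.CondP6 P l →
      ∀ T : Cor22.ThetaVolumeDatumAt P l, T.negAbsLogQ ≤ T.negLogTheta + ε P l T)
    (hTolK : ∀ P : NFPoint, P ∈ UP → ∀ l : ℕ, l.Prime → 5 ≤ l →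
      Cor22.AdmitsCore P → Cor22.CondP2 P l → Cor22.CondP5 P l → Cor22.CondP6 P l →
      ∀ T : Cor22.ThetaVolumeDatumAt P l,
        ε P l T ≤ ((l : ℝ) + 1) / 4 * (5 * ((((2 ^ 12 * 3 ^ 3 * 5 * Cor22.dmod P : ℕ) : ℝ)) * l + K)))
    (hreg : ∀ P : NFPoint, P ∈ UP → ∀ l : ℕ, l.Prime → 5 ≤ l →
      Cor22.AdmitsCore P → Cor22.CondP2 P l → Cor22.CondP5 P l → Cor22.CondP6 P l →
      ∀ T : Cor22.ThetaVolumeDatumAt P l,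
        (letI := T.instFieldF; letI := T.instNumberFieldF; letI := T.instAlgebraF; letI := T.instFieldK
         letI := T.instNumberFieldK; letI := T.instAlgebraK; letI := T.instFieldFbar; letI := T.instAlgebraFbar
         letI := T.instAlgebraKFbar; letI := T.instIsElliptic
         ¬ (∀ p ∈ T.I.supportPrimes, ∀ v w : placesOver (fieldOfModuli T.E) p,
            (Summit.ABC.IUTFork.DHData.ofInput T.I).logQloc p v = (Summit.ABC.IUTFork.DHData.ofInput T.I).logQloc p w)) →
        T.HullEstimateOf
          (((l : ℝ) + 1) / 4 *
            ((1 + 12 * (Cor22.dmod P : ℝ) / l) * (P.logDiff + Cor22.logCondAvoid P {2, l})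
              + 2 * Real.log l + 52
              + 20 / 3 * Real.log (((2 ^ 12 * 3 ^ 3 * 5 * Cor22.dmod P : ℕ) : ℝ) * (l : ℝ))
                * (Nat.primeCounting (2 ^ 12 * 3 ^ 3 * 5 * Cor22.dmod P * l) : ℝ)))) :
    _root_.ABC :=
  Summit.ABC.ABC.Theses.IUTThetaPilot.closes (ThetaPartII_of_cor312Slack_budget hK ε h312ε hTolK hreg)
    Summit.ABC.ABC.Theorems.genEllTwo_holds Summit.ABC.ABC.Theorems.JInvWlog_proof

/-- **The ABSOLUTE budget form** (the sentence of rh-lead's MIN-SLICE.md (ii)): for `K ≥ 0` in the currency of `−|log(Θ)|` / the squeeze,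
[NUMΣ] the weakened Corollary with slack `ε(P,l,T)`, [TOL+K] `ε(P,l,T) ≤ ((l+1)/4)·5·d*_mod·l + K` (the `η`-free tolerance of record PLUS the
absolute amount `K`) and [CONE] `hreg` ⟹ `ABC`; inside, `K ≤ ((l+1)/4)·5·(K/10)` (`l ≥ 7`), so this is `ABC_of_cor312Slack_budget` with budget `K/10`,
i.e. the constant of (C2) becomes `C_K + 40·(K/10) = C_K + 4·K` — «`E_off⁺ ≤ Tol + K` costs `C_K ↦ C_K + 4K`» (sharper: `+ 32K/(l+1)`), `H_unif`
unchanged; `l ≥ 7` from (P6) as in `thm110Legendre_of_pointwise`. CONDITIONAL; nothing is asserted about the hypotheses; no side taken. [cite: Mochizuki2012, IUTchIV Cor. 2.2 (ii) p. 47]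
[claim: Mochizuki2012, status: disputed] -/
theorem ABC_of_cor312Slack_absBudget {K : ℝ} (hK : 0 ≤ K)
    (ε : ∀ (P : NFPoint) (l : ℕ), Cor22.ThetaVolumeDatumAt P l → ℝ)
    (h312ε : ∀ P : NFPoint, P ∈ UP → ∀ l : ℕ, l.Prime → 5 ≤ l →
      Cor22.AdmitsCore P → Cor22.CondP2 P l → Cor22.CondP5 P l → Cor22.CondP6 P l →
      ∀ T : Cor22.ThetaVolumeDatumAt P l, T.negAbsLogQ ≤ T.negLogTheta + ε P l T)
    (hTolK : ∀ P : NFPoint, P ∈ UP → ∀ l : ℕ, l.Prime → 5 ≤ l →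
      Cor22.AdmitsCore P → Cor22.CondP2 P l → Cor22.CondP5 P l → Cor22.CondP6 P l →
      ∀ T : Cor22.ThetaVolumeDatumAt P l,
        ε P l T ≤ ((l : ℝ) + 1) / 4 * (5 * ((((2 ^ 12 * 3 ^ 3 * 5 * Cor22.dmod P : ℕ) : ℝ)) * l)) + K)
    (hreg : ∀ P : NFPoint, P ∈ UP → ∀ l : ℕ, l.Prime → 5 ≤ l →
      Cor22.AdmitsCore P → Cor22.CondP2 P l → Cor22.CondP5 P l → Cor22.CondP6 P l →
      ∀ T : Cor22.ThetaVolumeDatumAt P l,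
        (letI := T.instFieldF; letI := T.instNumberFieldF; letI := T.instAlgebraF; letI := T.instFieldK
         letI := T.instNumberFieldK; letI := T.instAlgebraK; letI := T.instFieldFbar; letI := T.instAlgebraFbar
         letI := T.instAlgebraKFbar; letI := T.instIsElliptic
         ¬ (∀ p ∈ T.I.supportPrimes, ∀ v w : placesOver (fieldOfModuli T.E) p,
            (Summit.ABC.IUTFork.DHData.ofInput T.I).logQloc p v = (Summit.ABC.IUTFork.DHData.ofInput T.I).logQloc p w)) →
        T.HullEstimateOf
          (((l : ℝ) + 1) / 4 *
            ((1 + 12 * (Cor22.dmod P : ℝ) / l) * (P.logDiff + Cor22.logCondAvoid P {2, l})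
              + 2 * Real.log l + 52
              + 20 / 3 * Real.log (((2 ^ 12 * 3 ^ 3 * 5 * Cor22.dmod P : ℕ) : ℝ) * (l : ℝ))
                * (Nat.primeCounting (2 ^ 12 * 3 ^ 3 * 5 * Cor22.dmod P * l) : ℝ)))) :
    _root_.ABC := by
  refine ABC_of_cor312Slack_budget (K := K / 10) (by positivity) ε h312ε (fun P hP l hl h5 hcore hP2 hP5 h6 T => ?_) hreg
  refine le_trans (hTolK P hP l hl h5 hcore hP2 hP5 h6 T) ?_
  have hne : l ≠ 5 := by
    rintro rfl
    obtain ⟨F, hNF, hF⟩ := Cor22.exists_isThetaField P hP.1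
    haveI := hNF
    exact Cor22.not_condP6_five_of_isThetaField hP.1 F hF h6
  have hl7 : (7 : ℝ) ≤ l := by exact_mod_cast seven_le_of_prime_of_ne_five hl h5 hne
  have e : ((l : ℝ) + 1) / 4 * (5 * ((((2 ^ 12 * 3 ^ 3 * 5 * Cor22.dmod P : ℕ) : ℝ)) * l + K / 10)) =
      ((l : ℝ) + 1) / 4 * (5 * ((((2 ^ 12 * 3 ^ 3 * 5 * Cor22.dmod P : ℕ) : ℝ)) * l)) + ((l : ℝ) + 1) / 8 * K := by ring
  rw [e]
  nlinarith

end Summit.ABC.IUTFork.Conditional.Cor312Slack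

end
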